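import Summits.MatrixMultiplication.MatrixMultiplication.Theorems.TetraDiagonalSymm
import Literature.Computability.AlgebraicComplexity.KroneckerRank
import HarnessLib

/-!
# TetraDiagonalTriangles — the half-triangle cover at a finite level:
`R₄(Z_{n·n}^{(e·e)}) ≤ R(⟨e,n,n⟩)⁴`

(decomp-mm lens 6, generation 19; kernel D1 of NODE-g19 §2(d)(iv), continuing `TetraDiagonalSymm`.
Cut of record UNCHANGED; theorems about the thin-diagonal family `Z_n^{(d)}` (`diagTetra`), no item.)

THE COVER. The doubled thin tetrahedron `2·Z^ε` is the edge-disjoint union of its four triangles, and in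
`Z^ε` every triangle contains exactly ONE matching edge (`01` or `23`): so each of the four triangle
factors of the pointwise factorisation of `T(K₄)_{n·n}` (`tetra_sq_apply`, labels `Fin (n·n) ≃ Fin n × Fin n`,
first component routed to the triangle with the larger missing vertex) becomes, after thinning the
matching labels to the SQUARE `{(p, q) | p < e ∧ q < e}`, a zero-padded RECTANGULAR matrix multiplication
tensor `⟨e,n,n⟩` (triangles through `01`) or `⟨n,e,n⟩` (triangles through `23`).

WHAT IS PROVED (every field; sorry-free, no new axiom / instance / notation / Prop-def):
* §14 the zero-padded tensors `padMM₁ = [a.1 < e]·⟨n,n,n⟩`, `padMM₂ = [b.2 < e]·⟨n,n,n⟩` have rank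
  `≤ R(⟨e,n,n⟩)` (`tensorRank_padMM₁_le`, `tensorRank_padMM₂_le`; transport of a triad decomposition,
  Bläser 2013 Lemma 5.5 for `R(⟨n,e,n⟩) = R(⟨e,n,n⟩)`);
* §15 the square-thinned tetrahedron `sqThinTetra n e` at level `n·n`, its pointwise factorisation into
  the four padded triangle factors (`sqThinTetra_apply`), the cover decomposition
  (`sqThinTetra_eq_sum_cover`, `r²s²` rank-one terms) and `R₄(sqThinTetra n e) ≤ R(⟨e,n,n⟩)⁴`;
* §16 a permutation of `Fin (n·n)` carrying the initial segment `{< e·e}` onto the square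
  (`exists_perm_thin_sq`, via `Equiv.subtypeCongr`), along which `Z_{n·n}^{(e·e)}` is the pullback of
  `sqThinTetra n e` (`tetra_relabel`), whence the FINITE HALF-TRIANGLE COVER
  `tensorRankD_diagTetra_sq_le : e ≤ n → R₄(Z_{n·n}^{(e·e)}) ≤ R(⟨e,n,n⟩)⁴`.
The exponent form `ω_diag(ε) ≤ 2·ω(1,ε,1)` and the rungs `ω_diag(ε) = 4` for `ε ≤ α` are kernel D2
(`TetraDiagonalRungs`).
Sources: [corpus:paper-arxiv-1609.07476 Prop. 1.1.26 (proof), §2.1 `T_f(G)`] · [Blaser2013, Lemma 5.5] ·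
tree `TetrahedronTensor` (§Cover), `TetraDiagonalCore`, `TetraDiagonalSymm`.
-/

noncomputable section

set_option linter.dupNamespace false

open scoped BigOperators
open Filter Asymptotics
open Literature.Computability.AlgebraicComplexity
open Summit.MatrixMultiplication.MatrixMultiplication.Theorems.TetrahedronTensor
open Summit.MatrixMultiplication.MatrixMultiplication.Theses.TetrahedronCarving

namespace Summit.MatrixMultiplication.MatrixMultiplication.Theorems.TetraDiagonal

/-! ## §14 Zero-padded rectangular matrix multiplication tensors -/

section Padded

variable (F : Type*) [Field F]

/-- `⟨e,n,n⟩` padded by zero into the format of `⟨n,n,n⟩`: the first shared index (rows of the first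
factor) restricted to `< e`. -/
def padMM₁ (n e : ℕ) : Fin n × Fin n → Fin n × Fin n → Fin n × Fin n → F :=
  fun a b c => (if ((a.1 : Fin n) : ℕ) < e then (1 : F) else 0) * matMulTensor F n n n a b c

/-- `⟨n,e,n⟩` padded by zero into the format of `⟨n,n,n⟩`: the middle shared index restricted to `< e`. -/
def padMM₂ (n e : ℕ) : Fin n × Fin n → Fin n × Fin n → Fin n × Fin n → F :=
  fun a b c => (if ((b.2 : Fin n) : ℕ) < e then (1 : F) else 0) * matMulTensor F n n n a b c

variable {F}

/-- `R(padMM₁ n e) ≤ R(⟨e,n,n⟩)`: transport of a triad decomposition of `⟨e,n,n⟩` (extension by zero).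
[cite: Blaser2013, §4] -/
theorem tensorRank_padMM₁_le (n e : ℕ) :
    tensorRank (padMM₁ F n e) ≤ tensorRank (matMulTensor F e n n) := by
  classical
  obtain ⟨w, u, v, hdec⟩ := exists_triad_decomposition_tensorRank (matMulTensor F e n n)
  have hMM : ∀ a b c, matMulTensor F e n n a b c = ∑ j, w j a * u j b * v j c := fun a b c => by
    have h := congrFun (congrFun (congrFun hdec a) b) c
    rw [h, Finset.sum_apply, Finset.sum_apply, Finset.sum_apply]
    rfl
  refine tensorRank_le_of_eq_sum
    (fun j a => if h : ((a.1 : Fin n) : ℕ) < e then w j (⟨a.1, h⟩, a.2) else 0)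
    (fun j b => if h : ((b.1 : Fin n) : ℕ) < e then u j (⟨b.1, h⟩, b.2) else 0) v ?_
  funext a b c
  rw [Finset.sum_apply, Finset.sum_apply, Finset.sum_apply]
  simp only [triad_apply, padMM₁]
  by_cases ha : ((a.1 : Fin n) : ℕ) < e
  · by_cases hb : ((b.1 : Fin n) : ℕ) < e
    · simp only [ha, hb, if_true, dif_pos, one_mul]
      rw [← hMM]
      simp only [matMulTensor, Fin.ext_iff]
    · have hab : ¬ (a.1 = b.1 ∧ b.2 = c.1 ∧ a.2 = c.2) := fun h => hb (h.1 ▸ ha)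
      simp only [ha, hb, if_true, dif_pos, dif_neg, not_false_eq_true, matMulTensor, hab,
        if_false, mul_zero, zero_mul, Finset.sum_const_zero]
  · simp only [ha, if_false, dif_neg, not_false_eq_true, zero_mul, Finset.sum_const_zero]

/-- `R(padMM₂ n e) ≤ R(⟨e,n,n⟩)` (transport from `⟨n,e,n⟩`, and `R(⟨n,e,n⟩) = R(⟨e,n,n⟩)`, Bläser 2013,
Lemma 5.5). [cite: Blaser2013, Lemma 5.5] -/
theorem tensorRank_padMM₂_le (n e : ℕ) :
    tensorRank (padMM₂ F n e) ≤ tensorRank (matMulTensor F e n n) := by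
  classical
  rw [← (Blaser2013_lemma55 F n e n).2.1]
  obtain ⟨w, u, v, hdec⟩ := exists_triad_decomposition_tensorRank (matMulTensor F n e n)
  have hMM : ∀ a b c, matMulTensor F n e n a b c = ∑ j, w j a * u j b * v j c := fun a b c => by
    have h := congrFun (congrFun (congrFun hdec a) b) c
    rw [h, Finset.sum_apply, Finset.sum_apply, Finset.sum_apply]
    rfl
  refine tensorRank_le_of_eq_sum w
    (fun j b => if h : ((b.2 : Fin n) : ℕ) < e then u j (b.1, ⟨b.2, h⟩) else 0)
    (fun j c => if h : ((c.1 : Fin n) : ℕ) < e then v j (⟨c.1, h⟩, c.2) else 0) ?_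
  funext a b c
  rw [Finset.sum_apply, Finset.sum_apply, Finset.sum_apply]
  simp only [triad_apply, padMM₂]
  by_cases hb : ((b.2 : Fin n) : ℕ) < e
  · by_cases hc : ((c.1 : Fin n) : ℕ) < e
    · simp only [hb, hc, if_true, dif_pos, one_mul]
      rw [← hMM]
      simp only [matMulTensor, Fin.ext_iff]
    · have hbc : ¬ (a.1 = b.1 ∧ b.2 = c.1 ∧ a.2 = c.2) := fun h => hc (h.2.1 ▸ hb)
      simp only [hb, hc, if_true, dif_pos, dif_neg, not_false_eq_true, matMulTensor, hbc,
        if_false, mul_zero, Finset.sum_const_zero]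
  · simp only [hb, if_false, dif_neg, not_false_eq_true, zero_mul, mul_zero, Finset.sum_const_zero]

end Padded

/-! ## §15 The square-thinned tetrahedron at level `n·n` and its triangle cover -/

section Square

variable (F : Type*) [Field F]

/-- Square thin indicator of a pair label `y ≃ (p, q)`: `[p < e]·[q < e]`. -/
def sqInd (n e : ℕ) (y : Fin (n * n)) : F :=
  (if (((finProdFinEquiv.symm y).1 : Fin n) : ℕ) < e then (1 : F) else 0) *
    (if (((finProdFinEquiv.symm y).2 : Fin n) : ℕ) < e then (1 : F) else 0)

/-- Leg-wise restriction functions of the square-thinned tetrahedron (vertex `0` tests its slot `0` =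
edge `01`, vertex `2` its slot `2` = edge `23`). -/
def sqLegs (n e : ℕ) : Fin 4 → Fin ((n * n) ^ 3) → F :=
  ![fun x => sqInd F n e (finFunctionFinEquiv.symm x 0), fun _ => 1,
    fun x => sqInd F n e (finFunctionFinEquiv.symm x 2), fun _ => 1]

/-- The square-thinned tetrahedron `Z^□_{n,e}` at level `n·n`: matching labels restricted to the square
`{(p,q) | p, q < e}` of pair labels. -/
def sqThinTetra (n e : ℕ) : (Fin 4 → Fin ((n * n) ^ 3)) → F :=
  fun i => (∏ v, sqLegs F n e v (i v)) * tetra F (n * n) i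

/-- The four legs of the cover summand indexed by `l = ((l₀,l₁),(l₂,l₃))`: triangles `0, 1` (through the
matching edge `23`) use a triad decomposition `(w,u,v)` of `padMM₂`, triangles `2, 3` (through `01`) a
triad decomposition `(w',u',v')` of `padMM₁`. (CVZ19, Prop. 1.1.26 (proof)). -/
def sqCoverLeg {n r s : ℕ} (w u v : Fin r → Fin n × Fin n → F) (w' u' v' : Fin s → Fin n × Fin n → F)
    (l : (Fin r × Fin r) × (Fin s × Fin s)) : Fin 4 → Fin ((n * n) ^ 3) → F :=
  ![fun x => w l.1.2 (P₂ x 1, P₂ x 2) * w' l.2.1 (P₂ x 0, P₁ x 2) * w' l.2.2 (P₁ x 0, P₁ x 1),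
    fun x => w l.1.1 (P₂ x 1, P₂ x 2) * u' l.2.1 (P₂ x 0, P₁ x 2) * u' l.2.2 (P₁ x 0, P₁ x 1),
    fun x => u l.1.1 (P₂ x 1, P₂ x 2) * u l.1.2 (P₂ x 0, P₁ x 2) * v' l.2.2 (P₁ x 1, P₁ x 0),
    fun x => v l.1.1 (P₂ x 2, P₂ x 1) * v l.1.2 (P₁ x 2, P₂ x 0) * v' l.2.1 (P₁ x 1, P₁ x 0)]

variable {F}

/-- The leg product of `sqLegs`. -/
theorem prod_sqLegs {n e : ℕ} (i : Fin 4 → Fin ((n * n) ^ 3)) :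
    ∏ v, sqLegs F n e v (i v) =
      sqInd F n e (finFunctionFinEquiv.symm (i 0) 0) * sqInd F n e (finFunctionFinEquiv.symm (i 2) 2) := by
  rw [Fin.prod_univ_four]
  simp [sqLegs]

/-- `Z^□` decomposes over rank-one tensors (leg-wise restriction of `T(K₄)_{n·n}`). -/
theorem sqThinTetra_decomposable (n e : ℕ) :
    ∃ s : ℕ, ∃ g : Fin s → ((Fin 4 → Fin ((n * n) ^ 3)) → F),
      (∀ k, g k ∈ rankOneTensors F ((n * n) ^ 3) 4) ∧ ∑ k, g k = sqThinTetra F n e :=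
  legMul_decomposable (tetra F (n * n)) (sqLegs F n e) (tetra_decomposable (n * n))

/-- **Pointwise triangle factorisation of `Z^□`**: the two square tests split into four one-component
tests, one per triangle, turning the four factors of `tetra_sq_apply` into padded rectangular factors
`padMM₂, padMM₂, padMM₁, padMM₁` (triangles `0, 1, 2, 3`). (CVZ19, Prop. 1.1.26 (proof), §2.1). -/
theorem sqThinTetra_apply {n e : ℕ} (i : Fin 4 → Fin ((n * n) ^ 3)) :
    sqThinTetra F n e i =
      padMM₂ F n e (P₂ (i 1) 1, P₂ (i 1) 2) (P₂ (i 2) 1, P₂ (i 2) 2) (P₂ (i 3) 2, P₂ (i 3) 1) *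
      padMM₂ F n e (P₂ (i 0) 1, P₂ (i 0) 2) (P₂ (i 2) 0, P₁ (i 2) 2) (P₁ (i 3) 2, P₂ (i 3) 0) *
      padMM₁ F n e (P₂ (i 0) 0, P₁ (i 0) 2) (P₂ (i 1) 0, P₁ (i 1) 2) (P₁ (i 3) 1, P₁ (i 3) 0) *
      padMM₁ F n e (P₁ (i 0) 0, P₁ (i 0) 1) (P₁ (i 1) 0, P₁ (i 1) 1) (P₁ (i 2) 1, P₁ (i 2) 0) := by
  simp only [sqThinTetra, prod_sqLegs, tetra_sq_apply, padMM₁, padMM₂, sqInd, P₁, P₂]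
  ring

/-- Quadruple sums factor: `(Σ f₀)(Σ f₁)((Σ g₀)(Σ g₁)) = Σ_{((a,b),(c,d))} f₀ a f₁ b (g₀ c g₁ d)`. -/
theorem sum_mul_sum_mul_sum_mul_sum {r s : ℕ} (f₀ f₁ : Fin r → F) (g₀ g₁ : Fin s → F) :
    (∑ j, f₀ j) * (∑ j, f₁ j) * ((∑ j, g₀ j) * (∑ j, g₁ j)) =
      ∑ l : (Fin r × Fin r) × (Fin s × Fin s), f₀ l.1.1 * f₁ l.1.2 * (g₀ l.2.1 * g₁ l.2.2) := by
  rw [Finset.sum_mul_sum, ← Fintype.sum_prod_type', Finset.sum_mul_sum, ← Fintype.sum_prod_type',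
    Finset.sum_mul_sum, ← Fintype.sum_prod_type']

/-- **The cover decomposition of `Z^□`**: from triad decompositions of `padMM₂` (length `r`) and
`padMM₁` (length `s`), `Z^□_{n,e} = Σ_l ⊗_v sqCoverLeg_l(v)` with `r²s²` rank-one terms.
[cite: ChristandlVranaZuiddam2016, Prop. 1.1.26 (proof)] -/
theorem sqThinTetra_eq_sum_cover {n e r s : ℕ} {w u v : Fin r → Fin n × Fin n → F}
    {w' u' v' : Fin s → Fin n × Fin n → F}
    (h₂ : padMM₂ F n e = ∑ j, triad (w j) (u j) (v j))
    (h₁ : padMM₁ F n e = ∑ j, triad (w' j) (u' j) (v' j)) :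
    ∑ l : (Fin r × Fin r) × (Fin s × Fin s), rankOneTensor (sqCoverLeg F w u v w' u' v' l) =
      sqThinTetra F n e := by
  classical
  have hM₂ : ∀ a b c, padMM₂ F n e a b c = ∑ j, w j a * u j b * v j c := fun a b c => by
    have h := congrFun (congrFun (congrFun h₂ a) b) c
    rw [h, Finset.sum_apply, Finset.sum_apply, Finset.sum_apply]
    rfl
  have hM₁ : ∀ a b c, padMM₁ F n e a b c = ∑ j, w' j a * u' j b * v' j c := fun a b c => by
    have h := congrFun (congrFun (congrFun h₁ a) b) c
    rw [h, Finset.sum_apply, Finset.sum_apply, Finset.sum_apply]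
    rfl
  funext i
  -- the four triangle terms at the point `i`
  let T₀ : Fin r → F := fun j =>
    w j (P₂ (i 1) 1, P₂ (i 1) 2) * u j (P₂ (i 2) 1, P₂ (i 2) 2) * v j (P₂ (i 3) 2, P₂ (i 3) 1)
  let T₁ : Fin r → F := fun j =>
    w j (P₂ (i 0) 1, P₂ (i 0) 2) * u j (P₂ (i 2) 0, P₁ (i 2) 2) * v j (P₁ (i 3) 2, P₂ (i 3) 0)
  let T₂ : Fin s → F := fun j =>
    w' j (P₂ (i 0) 0, P₁ (i 0) 2) * u' j (P₂ (i 1) 0, P₁ (i 1) 2) * v' j (P₁ (i 3) 1, P₁ (i 3) 0)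
  let T₃ : Fin s → F := fun j =>
    w' j (P₁ (i 0) 0, P₁ (i 0) 1) * u' j (P₁ (i 1) 0, P₁ (i 1) 1) * v' j (P₁ (i 2) 1, P₁ (i 2) 0)
  calc (∑ l : (Fin r × Fin r) × (Fin s × Fin s), rankOneTensor (sqCoverLeg F w u v w' u' v' l)) i
      = ∑ l : (Fin r × Fin r) × (Fin s × Fin s), T₀ l.1.1 * T₁ l.1.2 * (T₂ l.2.1 * T₃ l.2.2) := by
        rw [Finset.sum_apply]
        refine Finset.sum_congr rfl fun l _ => ?_
        rw [rankOneTensor_apply, Fin.prod_univ_four]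
        simp only [sqCoverLeg, T₀, T₁, T₂, T₃, Matrix.cons_val_zero, Matrix.cons_val_one,
          Matrix.cons_val_two, Matrix.cons_val_three, Matrix.head_cons, Matrix.tail_cons]
        ring
    _ = (∑ j, T₀ j) * (∑ j, T₁ j) * ((∑ j, T₂ j) * (∑ j, T₃ j)) :=
        (sum_mul_sum_mul_sum_mul_sum T₀ T₁ T₂ T₃).symm
    _ = sqThinTetra F n e i := by
        rw [sqThinTetra_apply, hM₂, hM₂, hM₁, hM₁]
        simp only [T₀, T₁, T₂, T₃]
        ring

/-- **`R₄(Z^□_{n,e}) ≤ R(⟨e,n,n⟩)⁴`**: the four half-triangles. [cite: ChristandlVranaZuiddam2016, Prop. 1.1.26] -/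
theorem tensorRankD_sqThinTetra_le (n e : ℕ) :
    tensorRankD (sqThinTetra F n e) ≤ tensorRank (matMulTensor F e n n) ^ 4 := by
  classical
  obtain ⟨w, u, v, h₂⟩ := exists_triad_decomposition_tensorRank (padMM₂ F n e)
  obtain ⟨w', u', v', h₁⟩ := exists_triad_decomposition_tensorRank (padMM₁ F n e)
  have hsum := sqThinTetra_eq_sum_cover h₂ h₁
  have hr := tensorRank_padMM₂_le (F := F) n e
  have hs := tensorRank_padMM₁_le (F := F) n e
  have hcard : Fintype.card ((Fin (tensorRank (padMM₂ F n e)) × Fin (tensorRank (padMM₂ F n e))) ×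
      (Fin (tensorRank (padMM₁ F n e)) × Fin (tensorRank (padMM₁ F n e)))) =
      tensorRank (padMM₂ F n e) * tensorRank (padMM₂ F n e) *
        (tensorRank (padMM₁ F n e) * tensorRank (padMM₁ F n e)) := by
    simp only [Fintype.card_prod, Fintype.card_fin]
  calc tensorRankD (sqThinTetra F n e)
      ≤ Fintype.card ((Fin (tensorRank (padMM₂ F n e)) × Fin (tensorRank (padMM₂ F n e))) ×
          (Fin (tensorRank (padMM₁ F n e)) × Fin (tensorRank (padMM₁ F n e)))) := by
        let eq := Fintype.equivFin ((Fin (tensorRank (padMM₂ F n e)) × Fin (tensorRank (padMM₂ F n e))) ×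
          (Fin (tensorRank (padMM₁ F n e)) × Fin (tensorRank (padMM₁ F n e))))
        refine tensorRankD_le_of_eq_sum (fun k => sqCoverLeg F w u v w' u' v' (eq.symm k)) ?_
        rw [← hsum]
        exact Fintype.sum_equiv eq.symm _ _ (fun _ => rfl)
    _ = tensorRank (padMM₂ F n e) * tensorRank (padMM₂ F n e) *
          (tensorRank (padMM₁ F n e) * tensorRank (padMM₁ F n e)) := hcard
    _ ≤ tensorRank (matMulTensor F e n n) * tensorRank (matMulTensor F e n n) *
          (tensorRank (matMulTensor F e n n) * tensorRank (matMulTensor F e n n)) :=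
        Nat.mul_le_mul (Nat.mul_le_mul hr hr) (Nat.mul_le_mul hs hs)
    _ = tensorRank (matMulTensor F e n n) ^ 4 := by ring

end Square

/-! ## §16 Relabelling the square onto the initial segment: `R₄(Z_{n·n}^{(e·e)}) ≤ R(⟨e,n,n⟩)⁴` -/

section Relabel

variable {F : Type*} [Field F]

/-- The initial segment `{y < e·e}` of `Fin (n·n)` has `e·e` elements (`e ≤ n`). [folklore] -/
theorem card_subtype_lt_sq {n e : ℕ} (he : e ≤ n) :
    Fintype.card {y : Fin (n * n) // (y : ℕ) < e * e} = e * e := by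
  have hee : e * e ≤ n * n := Nat.mul_le_mul he he
  let eqv : {y : Fin (n * n) // (y : ℕ) < e * e} ≃ Fin (e * e) :=
    ⟨fun y => ⟨(y.1 : ℕ), y.2⟩, fun z => ⟨Fin.castLE hee z, z.isLt⟩,
      fun y => Subtype.ext (Fin.ext rfl), fun z => Fin.ext rfl⟩
  rw [Fintype.card_congr eqv, Fintype.card_fin]

/-- The square `{(p,q) | p, q < e}` of pair labels has `e·e` elements (`e ≤ n`). [folklore] -/
theorem card_subtype_sq {n e : ℕ} (he : e ≤ n) :
    Fintype.card {y : Fin (n * n) // (((finProdFinEquiv.symm y).1 : Fin n) : ℕ) < e ∧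
      (((finProdFinEquiv.symm y).2 : Fin n) : ℕ) < e} = e * e := by
  let eqv : {y : Fin (n * n) // (((finProdFinEquiv.symm y).1 : Fin n) : ℕ) < e ∧
      (((finProdFinEquiv.symm y).2 : Fin n) : ℕ) < e} ≃ Fin e × Fin e :=
    ⟨fun y => (⟨_, y.2.1⟩, ⟨_, y.2.2⟩),
      fun z => ⟨finProdFinEquiv (Fin.castLE he z.1, Fin.castLE he z.2), by
        simp only [Equiv.symm_apply_apply, Fin.val_castLE]; exact ⟨z.1.isLt, z.2.isLt⟩⟩,
      fun y => by
        apply Subtype.ext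
        simp only
        conv_rhs => rw [← finProdFinEquiv.apply_symm_apply y.1]
        rfl,
      fun z => by
        ext <;> simp only [Equiv.symm_apply_apply, Fin.val_castLE]⟩
  rw [Fintype.card_congr eqv, Fintype.card_prod, Fintype.card_fin]

/-- **A permutation of the pair labels carrying the initial segment `{< e·e}` onto the square**
(`Equiv.extendSubtype` of a bijection between two subtypes of equal size). [folklore] -/
theorem exists_perm_thin_sq {n e : ℕ} (he : e ≤ n) :
    ∃ σ : Equiv.Perm (Fin (n * n)), ∀ y : Fin (n * n),
      ((y : ℕ) < e * e ↔ ((((finProdFinEquiv.symm (σ y)).1 : Fin n) : ℕ) < e ∧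
        (((finProdFinEquiv.symm (σ y)).2 : Fin n) : ℕ) < e)) := by
  have h1 : Fintype.card {y : Fin (n * n) // (y : ℕ) < e * e} =
      Fintype.card {y : Fin (n * n) // (((finProdFinEquiv.symm y).1 : Fin n) : ℕ) < e ∧
        (((finProdFinEquiv.symm y).2 : Fin n) : ℕ) < e} := by
    rw [card_subtype_lt_sq he, card_subtype_sq he]
  refine ⟨(Fintype.equivOfCardEq h1).extendSubtype, fun y => ⟨fun hy => ?_, fun hy => ?_⟩⟩
  · exact (Fintype.equivOfCardEq h1).extendSubtype_mem y hy
  · by_contra hy'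
    exact (Fintype.equivOfCardEq h1).extendSubtype_not_mem y hy' hy

/-- Along such a permutation the square test becomes the initial-segment test. -/
theorem sqInd_perm_apply {n e : ℕ} {σ : Equiv.Perm (Fin (n * n))}
    (hσ : ∀ y : Fin (n * n), ((y : ℕ) < e * e ↔ ((((finProdFinEquiv.symm (σ y)).1 : Fin n) : ℕ) < e ∧
      (((finProdFinEquiv.symm (σ y)).2 : Fin n) : ℕ) < e))) (y : Fin (n * n)) :
    sqInd F n e (σ y) = if (y : ℕ) < e * e then (1 : F) else 0 := by
  unfold sqInd
  rw [ite_one_zero_mul_ite]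
  exact if_congr (hσ y).symm rfl rfl

/-- **`R₄(Z_{n·n}^{(e·e)}) ≤ R₄(Z^□_{n,e})`**: `Z_{n·n}^{(e·e)}` is the pullback of the square-thinned
tetrahedron along the leg maps relabelling the two matching edges by `σ` (`tetra_relabel`). [folklore] -/
theorem tensorRankD_diagTetra_sq_le_sqThinTetra {n e : ℕ} (he : e ≤ n) :
    tensorRankD (diagTetra F (n * n) (e * e)) ≤ tensorRankD (sqThinTetra F n e) := by
  classical
  obtain ⟨σ, hσ⟩ := exists_perm_thin_sq he
  let ι : Fin 6 → Fin (n * n) → Fin (n * n) := ![⇑σ, id, id, id, id, ⇑σ]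
  have hι : ∀ k, Function.Injective (ι k) := by
    intro k
    fin_cases k
    · exact σ.injective
    · exact Function.injective_id
    · exact Function.injective_id
    · exact Function.injective_id
    · exact Function.injective_id
    · exact σ.injective
  let φ : Fin 4 → Fin ((n * n) ^ 3) → Fin ((n * n) ^ 3) := fun v x =>
    finFunctionFinEquiv fun j => ι (vertexLabels (fun k : Fin 6 => k) v j) (finFunctionFinEquiv.symm x j)
  have hι0 : ι 0 = ⇑σ := rfl
  have hι5 : ι 5 = ⇑σ := rfl
  have hpull : diagTetra F (n * n) (e * e) = fun i => sqThinTetra F n e (fun v => φ v (i v)) := by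
    funext i
    have ht := tetra_relabel (F := F) ι hι i
    simp only [sqThinTetra, prod_sqLegs, φ]
    rw [ht]
    simp only [diagTetra, prod_thinLegs, thinInd, Equiv.symm_apply_apply, vertexLabels,
      Matrix.cons_val_zero, Matrix.cons_val_two, Matrix.head_cons, Matrix.tail_cons, hι0, hι5,
      sqInd_perm_apply hσ]
  rw [hpull]
  exact tensorRankD_pullback_le (sqThinTetra F n e) φ (sqThinTetra_decomposable n e)

/-- **The finite half-triangle cover** `R₄(Z_{n·n}^{(e·e)}) ≤ R(⟨e,n,n⟩)⁴` (`e ≤ n`): at the square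
level, the thin tetrahedron with square matching labels is covered by two copies of `⟨e,n,n⟩` and two of
`⟨n,e,n⟩`. [cite: ChristandlVranaZuiddam2016, Prop. 1.1.26 (proof); §2.1] -/
theorem tensorRankD_diagTetra_sq_le {n e : ℕ} (he : e ≤ n) :
    tensorRankD (diagTetra F (n * n) (e * e)) ≤ tensorRank (matMulTensor F e n n) ^ 4 :=
  (tensorRankD_diagTetra_sq_le_sqThinTetra he).trans (tensorRankD_sqThinTetra_le n e)

end Relabel

end Summit.MatrixMultiplication.MatrixMultiplication.Theorems.TetraDiagonal
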